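import Summits.AtomisticToContinuum.Crystallization.Theorems.FrustratedLawDichotomyCellData
import Summits.AtomisticToContinuum.Crystallization.Theorems.FrustratedLawDichotomyCellEnclosures
import Summits.AtomisticToContinuum.Crystallization.Theorems.FrustratedLawDichotomyShellMinimum

/-!
# FrustratedLawDichotomy · crux `AperiodicFrustratedLawGap` (stmt-AtomisticToContinuum-27623) — CELL-SOUND VIII: INTEGER TEMPLATES AND
WINDOW CLASSES (cell decomp-a2c, lens-5 g113; continues `…CellData`; K-file format co-design, crit r1767 (3))

The K-file format of record for class-A rows (memo KFILE-FORMAT-g113): the template is an INTEGER lattice patch `z : ι → Fin 3 → ℤ` at a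
rational scale `h` (`a m = h·z m`), the cell is a near-identity metric box `|FᵀF − 1| ≤ ε`, the lists are INTEGER-RADIUS balls, and every
certified number is booked per WINDOW CLASS (labels with the same `|z m|²` share the window `[(1 − 3ε)h²|z|², (1 + 3ε)h²|z|²]`).  Then
* all-pairs separation is STRUCTURAL (`sep_of_intTemplate`: injectivity of `z`, one `decide`, replaces `|M|²` rational checks);
* list side conditions are DEFINITIONAL (`ballL`, `le_of_not_mem_ballL`, `le_dist_of_intRadius`, `le_norm_of_intRadius`);
* windows come from ONE integer per label (`sumSq_intTemplate`, `win_of_intTemplate`);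
* the host / debit / multiplier-free NASH numbers are CLASS LEMMAS (`host_of_nearId`, `deb_of_nearId`, `nn0_of_nearId`) over the booked
  window expressions `snbW`, `erbW`, `psiAbsW` (= the right-hand sides of (238) `secondNeg_le`, `energyRem_le_window`, `psiT_mem`).

House conventions: SI units · italic scalars, bold vectors, sans-serif tensors · numbered formulae only when referenced · en-dash for
ranges · References = cited works, numbered, alphabetical · no footnotes; Remarks at section ends · British spelling, -ise · Lennard-Jones
hyphenated; NASH capitalised as the Statement's notion · "folklore" tags standard bookkeeping; no new references are cited in this file.
-/

noncomputable section

namespace Summit.AtomisticToContinuum.Crystallization.Theorems.FrustratedLawDichotomyCellClasses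

open MeasureTheory Metric Set RealInnerProductSpace
open scoped BigOperators
open Summit.AtomisticToContinuum.Crystallization.Theorems.ChargedEnergyGapNegative (E3)
open Summit.AtomisticToContinuum.Crystallization.Theorems.FrustratedLawDichotomyCoherentFloorAlgebra
open Summit.AtomisticToContinuum.Crystallization.Theorems.FrustratedLawDichotomyCoherentFloor
open Summit.AtomisticToContinuum.Crystallization.Theorems.FrustratedLawDichotomyCellEnclosures
open Summit.AtomisticToContinuum.Crystallization.Theorems.FrustratedLawDichotomyShellMinimum (shellMin shellMin_le_phiT)
open Summit.AtomisticToContinuum.Crystallization.Theorems.FrustratedLawDichotomyCellMetric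
open Summit.AtomisticToContinuum.Crystallization.Theorems.FrustratedLawDichotomyCellAdmissible
open Summit.AtomisticToContinuum.Crystallization.Theorems.FrustratedLawDichotomyCellData

variable {ι : Type*} [DecidableEq ι]

/-! ## §1. Integer templates: structural separation, integer-radius lists, windows -/

omit [DecidableEq ι] in
/-- the template scalar: `Σᵢ (h·zᵢ)² = h²·Σᵢ zᵢ²` with the integer sum cast. [folklore] -/
theorem sumSq_intTemplate (h : ℝ) (z : Fin 3 → ℤ) : ∑ i, (h * (z i : ℝ)) ^ 2 = h ^ 2 * ((∑ i, z i ^ 2 : ℤ) : ℝ) := by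
  push_cast
  rw [Finset.mul_sum]
  refine Finset.sum_congr rfl fun i _ => by ring

omit [DecidableEq ι] in
/-- the template difference scalar. [folklore] -/
theorem sumSq_sub_intTemplate (h : ℝ) (z z' : Fin 3 → ℤ) :
    ∑ i, (h * (z i : ℝ) - h * (z' i : ℝ)) ^ 2 = h ^ 2 * ((∑ i, (z i - z' i) ^ 2 : ℤ) : ℝ) := by
  push_cast
  rw [Finset.mul_sum]
  refine Finset.sum_congr rfl fun i _ => by ring

omit [DecidableEq ι] in
/-- distinct integer vectors are at squared distance `≥ 1`. [folklore] -/
theorem one_le_sumSq_sub_of_ne {z z' : Fin 3 → ℤ} (hne : z ≠ z') : (1 : ℤ) ≤ ∑ i, (z i - z' i) ^ 2 := by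
  obtain ⟨i, hi⟩ := Function.ne_iff.mp hne
  have h1 : (1 : ℤ) ≤ (z i - z' i) ^ 2 := by
    have hne' : z i - z' i ≠ 0 := sub_ne_zero.mpr hi
    have := Int.one_le_abs hne'
    nlinarith [abs_mul_abs_self (z i - z' i), abs_nonneg (z i - z' i)]
  exact h1.trans (Finset.single_le_sum (f := fun j => (z j - z' j) ^ 2) (fun j _ => sq_nonneg _) (Finset.mem_univ i))

omit [DecidableEq ι] in
/-- ★ STRUCTURAL ALL-PAIRS SEPARATION of an integer template: injectivity of `z` on `M` (ONE `decide`) and ONE numeric fact `c < k·h²`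
give the separation clause of `…CellData.rowFloor_of_nearIdBox` for all `|M|²` pairs at once. [folklore] -/
theorem sep_of_intTemplate {z : ι → Fin 3 → ℤ} {M : Finset ι} (hinj : ∀ m ∈ M, ∀ m' ∈ M, m ≠ m' → z m ≠ z m') (h : ℝ) {c k : ℝ}
    (hk : 0 ≤ k) (hc : c < k * h ^ 2) :
    ∀ m ∈ M, ∀ m' ∈ M, m ≠ m' → c < k * ∑ i, (h * (z m i : ℝ) - h * (z m' i : ℝ)) ^ 2 := by
  intro m hm m' hm' hne
  rw [sumSq_sub_intTemplate]
  have h1 : (1 : ℝ) ≤ ((∑ i, (z m i - z m' i) ^ 2 : ℤ) : ℝ) := by exact_mod_cast one_le_sumSq_sub_of_ne (hinj m hm m' hm' hne)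
  calc c < k * h ^ 2 := hc
    _ = k * h ^ 2 * 1 := by ring
    _ ≤ k * h ^ 2 * ((∑ i, (z m i - z m' i) ^ 2 : ℤ) : ℝ) := mul_le_mul_of_nonneg_left h1 (mul_nonneg hk (sq_nonneg _))
    _ = k * (h ^ 2 * ((∑ i, (z m i - z m' i) ^ 2 : ℤ) : ℝ)) := by ring

omit [DecidableEq ι] in
/-- WINDOW clause from ONE integer per label: `Σ zᵢ² ≤ Z` and `k·h²·Z ≤ C` (`0 ≤ k`) give `k·Σ (h zᵢ)² ≤ C`. [folklore] -/
theorem win_of_intTemplate (h : ℝ) {z : Fin 3 → ℤ} {k C : ℝ} {Z : ℤ} (hk : 0 ≤ k) (hz : ∑ i, z i ^ 2 ≤ Z) (hnum : k * h ^ 2 * Z ≤ C) :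
    k * ∑ i, (h * (z i : ℝ)) ^ 2 ≤ C := by
  rw [sumSq_intTemplate]
  have h1 : ((∑ i, z i ^ 2 : ℤ) : ℝ) ≤ (Z : ℝ) := by exact_mod_cast hz
  calc k * (h ^ 2 * ((∑ i, z i ^ 2 : ℤ) : ℝ)) = k * h ^ 2 * ((∑ i, z i ^ 2 : ℤ) : ℝ) := by ring
    _ ≤ k * h ^ 2 * Z := mul_le_mul_of_nonneg_left h1 (mul_nonneg hk (sq_nonneg _))
    _ ≤ C := hnum

omit [DecidableEq ι] in
/-- LINEAR TEMPLATES (cells centred AWAY from the identity: `a m = T·z m` with a rational cell-centre factor `T`, ATLAS EDITION 1 general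
row): the template scalar is the Gram form of `TᵀT` on the integer label vector. [folklore] -/
theorem sumSq_linTemplate (T : Matrix (Fin 3) (Fin 3) ℝ) (z : Fin 3 → ℤ) :
    ∑ i, (T.mulVec (fun j => (z j : ℝ)) i) ^ 2 = gram (T.transpose * T) (fun j => (z j : ℝ)) (fun j => (z j : ℝ)) := by
  rw [← norm_sq_posL]
  unfold posL
  rw [EuclideanSpace.norm_eq, Real.sq_sqrt (Finset.sum_nonneg fun i _ => by positivity)]
  simp [Real.norm_eq_abs, sq_abs]

omit [DecidableEq ι] in
/-- the `ℚ`-cast of a linear template scalar: decided in `ℚ`, used in `ℝ`. [folklore] -/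
theorem sumSq_linTemplate_cast (TQ : Matrix (Fin 3) (Fin 3) ℚ) (z : Fin 3 → ℤ) :
    ∑ i, ((TQ.map (fun q : ℚ => (q : ℝ))).mulVec (fun j => (z j : ℝ)) i) ^ 2 = ((∑ i, (TQ.mulVec (fun j => (z j : ℚ)) i) ^ 2 : ℚ) : ℝ) := by
  push_cast [Matrix.mulVec, dotProduct, Matrix.map_apply]
  rfl

omit [DecidableEq ι] in
/-- ★ STRUCTURAL ALL-PAIRS SEPARATION of a LINEAR template `a m = T·z m` whose centre metric is near the identity, `|TᵀT − 1| ≤ η`: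
injectivity of `z` on `M` and ONE numeric fact `c < k·(1 − 3η)` (`0 ≤ k`, `0 ≤ 1 − 3η`). [folklore] -/
theorem sep_of_linTemplate {z : ι → Fin 3 → ℤ} {M : Finset ι} (hinj : ∀ m ∈ M, ∀ m' ∈ M, m ≠ m' → z m ≠ z m')
    (T : Matrix (Fin 3) (Fin 3) ℝ) {η c k : ℝ} (hT : ∀ i j, |(T.transpose * T) i j - (if i = j then 1 else 0)| ≤ η) (hk : 0 ≤ k)
    (hη : 0 ≤ 1 - 3 * η) (hc : c < k * (1 - 3 * η)) :
    ∀ m ∈ M, ∀ m' ∈ M, m ≠ m' → c < k * ∑ i, (T.mulVec (fun j => (z m j : ℝ)) i - T.mulVec (fun j => (z m' j : ℝ)) i) ^ 2 := by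
  intro m hm m' hm' hne
  have hsub : ∀ i, T.mulVec (fun j => (z m j : ℝ)) i - T.mulVec (fun j => (z m' j : ℝ)) i
      = T.mulVec (fun j => ((z m j - z m' j : ℤ) : ℝ)) i := by
    intro i; rw [← Pi.sub_apply, ← Matrix.mulVec_sub]; push_cast; rfl
  simp_rw [hsub]
  rw [sumSq_linTemplate]
  have h1 : (1 : ℝ) ≤ ∑ j, ((z m j - z m' j : ℤ) : ℝ) ^ 2 := by
    have := one_le_sumSq_sub_of_ne (hinj m hm m' hm' hne)
    exact_mod_cast this
  have h2 := gram_ge_nearId hT (fun j => ((z m j - z m' j : ℤ) : ℝ))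
  have h3 : 0 ≤ k * (1 - 3 * η) := mul_nonneg hk hη
  calc c < k * (1 - 3 * η) := hc
    _ = k * (1 - 3 * η) * 1 := by ring
    _ ≤ k * (1 - 3 * η) * ∑ j, ((z m j - z m' j : ℤ) : ℝ) ^ 2 := mul_le_mul_of_nonneg_left h1 h3
    _ = k * ((1 - 3 * η) * ∑ j, ((z m j - z m' j : ℤ) : ℝ) ^ 2) := by ring
    _ ≤ k * gram (T.transpose * T) (fun j => ((z m j - z m' j : ℤ) : ℝ)) (fun j => ((z m j - z m' j : ℤ) : ℝ)) :=
        mul_le_mul_of_nonneg_left h2 hk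

/-- INTEGER-RADIUS BALL of labels around a label `c`: the near lists of a K-file (`nb`, `nbr`, `nbh`, `ML`, `MN` are built from these). -/
def ballL (M : Finset ι) (z : ι → Fin 3 → ℤ) (ℓ : ℤ) (c : ι) : Finset ι := M.filter fun x => ∑ i, (z x i - z c i) ^ 2 < ℓ

omit [DecidableEq ι] in
/-- [folklore] -/
theorem ballL_subset (M : Finset ι) (z : ι → Fin 3 → ℤ) (ℓ : ℤ) (c : ι) : ballL M z ℓ c ⊆ M := Finset.filter_subset _ _

omit [DecidableEq ι] in
/-- the DEFINITIONAL list side condition: outside the ball the integer squared distance is `≥ ℓ`. [folklore] -/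
theorem le_of_not_mem_ballL {M : Finset ι} {z : ι → Fin 3 → ℤ} {ℓ : ℤ} {c x : ι} (hx : x ∈ M) (hn : x ∉ ballL M z ℓ c) :
    ℓ ≤ ∑ i, (z x i - z c i) ^ 2 := by
  by_contra hlt
  exact hn (Finset.mem_filter.mpr ⟨hx, lt_of_not_ge hlt⟩)

section NearId

variable {F : Matrix (Fin 3) (Fin 3) ℝ} {ε : ℝ}

omit [DecidableEq ι] in
/-- LIST SIDE CONDITION IN METRES: an integer squared distance `≥ ℓ` and `L² ≤ (1 − 3ε)·h²·ℓ` give `L ≤ dist` on the whole box. [folklore] -/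
theorem le_dist_of_intRadius (hG : ∀ i j, |(F.transpose * F) i j - (if i = j then 1 else 0)| ≤ ε) (hε : 0 ≤ 1 - 3 * ε) (h : ℝ)
    {z z' : Fin 3 → ℤ} {L : ℝ} {ℓ : ℤ} (hL : L ^ 2 ≤ (1 - 3 * ε) * h ^ 2 * ℓ) (hzz : ℓ ≤ ∑ i, (z i - z' i) ^ 2) :
    L ≤ dist (posL F fun i => h * (z i : ℝ)) (posL F fun i => h * (z' i : ℝ)) := by
  refine le_dist_of_nearId hG (hL.trans ?_)
  rw [sumSq_sub_intTemplate]
  have h1 : (ℓ : ℝ) ≤ ((∑ i, (z i - z' i) ^ 2 : ℤ) : ℝ) := by exact_mod_cast hzz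
  calc (1 - 3 * ε) * h ^ 2 * ℓ ≤ (1 - 3 * ε) * h ^ 2 * ((∑ i, (z i - z' i) ^ 2 : ℤ) : ℝ) :=
        mul_le_mul_of_nonneg_left h1 (mul_nonneg hε (sq_nonneg _))
    _ = (1 - 3 * ε) * (h ^ 2 * ((∑ i, (z i - z' i) ^ 2 : ℤ) : ℝ)) := by ring

omit [DecidableEq ι] in
/-- FAR-LABEL NORM: an integer squared norm `≥ ℓ` and `L² ≤ (1 − 3ε)·h²·ℓ` give `L ≤ ‖pos‖` on the whole box. [folklore] -/
theorem le_norm_of_intRadius (hG : ∀ i j, |(F.transpose * F) i j - (if i = j then 1 else 0)| ≤ ε) (hε : 0 ≤ 1 - 3 * ε) (h : ℝ)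
    {z : Fin 3 → ℤ} {L : ℝ} {ℓ : ℤ} (hL : L ^ 2 ≤ (1 - 3 * ε) * h ^ 2 * ℓ) (hz : ℓ ≤ ∑ i, z i ^ 2) :
    L ≤ ‖posL F fun i => h * (z i : ℝ)‖ := by
  refine le_norm_of_nearId hG (hL.trans ?_)
  rw [sumSq_intTemplate]
  have h1 : (ℓ : ℝ) ≤ ((∑ i, z i ^ 2 : ℤ) : ℝ) := by exact_mod_cast hz
  calc (1 - 3 * ε) * h ^ 2 * ℓ ≤ (1 - 3 * ε) * h ^ 2 * ((∑ i, z i ^ 2 : ℤ) : ℝ) := mul_le_mul_of_nonneg_left h1 (mul_nonneg hε (sq_nonneg _))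
    _ = (1 - 3 * ε) * (h ^ 2 * ((∑ i, z i ^ 2 : ℤ) : ℝ)) := by ring

/-! ## §2. Booked window expressions and the class lemmas -/

/-- booked second-negative-part bound over an `r²`-window (the right-hand side of (238) `secondNeg_le`). -/
def snbW (lo hi : ℝ) : ℝ := max 0 (-(-(1 / 2) * lo⁻¹ ^ 7 + 1 / 2 * hi⁻¹ ^ 4) + 2 * hi * max 0 (-(7 / 2 * hi⁻¹ ^ 8 - 2 * lo⁻¹ ^ 5)))

/-- booked energy remainder over an `r`-window at step `η` (the right-hand side of (238) `energyRem_le_window`). -/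
def erbW (rlo rhi η : ℝ) : ℝ :=
  max (14 / 3 * ((rlo - η) ^ 2)⁻¹ ^ 9) (5 / 3 * ((rlo - η) ^ 2)⁻¹ ^ 6) * (2 * rhi * η + η ^ 2) ^ 3
    + max (-(7 / 2 * (rhi ^ 2)⁻¹ ^ 8 - 2 * (rlo ^ 2)⁻¹ ^ 5)) (7 / 2 * (rlo ^ 2)⁻¹ ^ 8 - 2 * (rhi ^ 2)⁻¹ ^ 5) * (2 * rhi * η ^ 3 + 1 / 2 * η ^ 4)

/-- booked `|ψ|` bound over an `r²`-window (from (238) `psiT_mem` and `abs_le_max_neg`). -/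
def psiAbsW (lo hi : ℝ) : ℝ := max (-(hi⁻¹ ^ 4 - lo⁻¹ ^ 7)) (lo⁻¹ ^ 4 - hi⁻¹ ^ 7)

omit [DecidableEq ι] in
/-- [folklore] -/
theorem abs_psiT_le_psiAbsW {lo hi t : ℝ} (h0 : 0 < lo) (h1 : lo ≤ t) (h2 : t ≤ hi) : |psiT t| ≤ psiAbsW lo hi :=
  abs_le_max_neg (psiT_mem h0 h1 h2).1 (psiT_mem h0 h1 h2).2

omit [DecidableEq ι] in
/-- the `r`-window from the `r²`-window: `rlo² ≤ lo ≤ r²`, `r² ≤ hi ≤ rhi²`, `0 ≤ rlo`, `0 ≤ rhi`, `0 ≤ r` ⇒ `rlo ≤ r ≤ rhi`. [folklore] -/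
theorem rWindow_of_sq {r lo hi rlo rhi : ℝ} (hr : 0 ≤ r) (hrlo : 0 ≤ rlo) (hrhi : 0 ≤ rhi) (h1 : lo ≤ r ^ 2) (h2 : r ^ 2 ≤ hi)
    (hrlo2 : rlo ^ 2 ≤ lo) (hrhi2 : hi ≤ rhi ^ 2) : rlo ≤ r ∧ r ≤ rhi :=
  ⟨(pow_le_pow_iff_left₀ hrlo hr two_ne_zero).mp (hrlo2.trans h1), (pow_le_pow_iff_left₀ hr hrhi two_ne_zero).mp (h2.trans hrhi2)⟩

omit [DecidableEq ι] in
/-- ★ HOST CLASS LEMMA: on a near-identity box, a label with `lo ≤ (1 − 3ε)|v|²`, `(1 + 3ε)|v|² ≤ hi`, `0 < lo` and a booked host number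
`hq ≤ shellMin lo hi` satisfies the host hypothesis of (251) `lb_le_certFloorL_trunc`. [folklore] -/
theorem host_of_nearId (hG : ∀ i j, |(F.transpose * F) i j - (if i = j then 1 else 0)| ≤ ε) (v : Fin 3 → ℝ) {lo hi hq : ℝ}
    (h0 : 0 < lo) (hlo : lo ≤ (1 - 3 * ε) * ∑ i, v i ^ 2) (hhi : (1 + 3 * ε) * ∑ i, v i ^ 2 ≤ hi) (hh : hq ≤ shellMin lo hi) :
    hq ≤ phiT (‖posL F v‖ ^ 2) := by
  have hw := norm_sq_mem_nearId hG v
  exact hh.trans (shellMin_le_phiT h0 (hlo.trans hw.1) (hw.2.trans hhi))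

omit [DecidableEq ι] in
/-- ★ DEBIT CLASS LEMMA: the near-root debit hypothesis of (251) from the class windows and a booked number
`τ²·snbW lo hi + erbW rlo rhi τ ≤ dq`. [folklore] -/
theorem deb_of_nearId (hG : ∀ i j, |(F.transpose * F) i j - (if i = j then 1 else 0)| ≤ ε) (v : Fin 3 → ℝ) {lo hi rlo rhi τ dq : ℝ}
    (h0 : 0 < lo) (hlo : lo ≤ (1 - 3 * ε) * ∑ i, v i ^ 2) (hhi : (1 + 3 * ε) * ∑ i, v i ^ 2 ≤ hi)
    (hrlo2 : rlo ^ 2 ≤ lo) (hrhi : 0 ≤ rhi) (hrhi2 : hi ≤ rhi ^ 2) (hτ : 0 ≤ τ) (hτr : τ < rlo)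
    (hd : τ ^ 2 * snbW lo hi + erbW rlo rhi τ ≤ dq) :
    τ ^ 2 * secondNeg ‖posL F v‖ + energyRem ‖posL F v‖ τ ≤ dq := by
  have hw := norm_sq_mem_nearId hG v
  have h1 : lo ≤ ‖posL F v‖ ^ 2 := hlo.trans hw.1
  have h2 : ‖posL F v‖ ^ 2 ≤ hi := hw.2.trans hhi
  have hr := rWindow_of_sq (norm_nonneg _) (hτ.trans hτr.le) hrhi h1 h2 hrlo2 hrhi2
  have hs : secondNeg ‖posL F v‖ ≤ snbW lo hi := secondNeg_le h0 h1 h2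
  have he : energyRem ‖posL F v‖ τ ≤ erbW rlo rhi τ := energyRem_le_window hτ hτr hr.1 hr.2
  have := mul_le_mul_of_nonneg_left hs (sq_nonneg τ)
  linarith

omit [DecidableEq ι] in
/-- ★ MULTIPLIER-FREE NASH CLASS LEMMA: for a NASH-near label whose certificate coefficient vanishes (no interior neighbour carries a
multiplier), `‖ψ(‖x‖²)·x − 0‖ ≤ psiAbsW lo hi · rhi`. [folklore] -/
theorem nn0_of_nearId (hG : ∀ i j, |(F.transpose * F) i j - (if i = j then 1 else 0)| ≤ ε) (v : Fin 3 → ℝ) {lo hi rhi nq : ℝ}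
    (h0 : 0 < lo) (hlo : lo ≤ (1 - 3 * ε) * ∑ i, v i ^ 2) (hhi : (1 + 3 * ε) * ∑ i, v i ^ 2 ≤ hi) (hrhi : 0 ≤ rhi)
    (hrhi2 : hi ≤ rhi ^ 2) (hn : psiAbsW lo hi * rhi ≤ nq) {C : E3} (hC : C = 0) :
    ‖psiT (‖posL F v‖ ^ 2) • posL F v - C‖ ≤ nq := by
  have hw := norm_sq_mem_nearId hG v
  have h1 : lo ≤ ‖posL F v‖ ^ 2 := hlo.trans hw.1
  have h2 : ‖posL F v‖ ^ 2 ≤ hi := hw.2.trans hhi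
  have hr : ‖posL F v‖ ≤ rhi := (pow_le_pow_iff_left₀ (norm_nonneg _) hrhi two_ne_zero).mp (h2.trans hrhi2)
  rw [hC, sub_zero, norm_smul, Real.norm_eq_abs]
  have habs := abs_psiT_le_psiAbsW h0 h1 h2
  exact (mul_le_mul habs hr (norm_nonneg _) ((abs_nonneg _).trans habs)).trans hn

end NearId

end Summit.AtomisticToContinuum.Crystallization.Theorems.FrustratedLawDichotomyCellClasses

end
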